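import Literature.AlgebraicGeometry.Motives.FaltingsFinitenessI
import Literature.AlgebraicGeometry.Motives.AbelianVarietyDimZeroProofs
import Literature.AlgebraicGeometry.Motives.AbelianVarietyIsogenyProofs
import HarnessLib

/-!
# Faltings' Finiteness I in dimension zero (the unconditional base case)

`Literature.AlgebraicGeometry.Motives.AbelianVariety.finite_isoClasses_isogenous A`
(`Motives/FaltingsFinitenessI.lean`) is Faltings' **Finiteness I** — over a number field only
finitely many abelian varieties `B`, up to isomorphism, are isogenous to a given `A` (Milne,
*Abelian Varieties* (2008), Ch. IV, Thm. 1.1; Faltings, Invent. Math. 73 (1983), §6) — stated as a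
named fact without discharge: its proof (Faltings heights, Néron models, Tate–Raynaud, the
Hodge–Tate decomposition) is far outside the tree.  Those arguments concern abelian varieties of
positive dimension; the degenerate case `dim A = 0` is separate and elementary, and this file
proves it unconditionally over an arbitrary field `K`:

* `nonempty_iso_of_dim_eq_zero` — two abelian varieties of dimension `0` are isomorphic: by
  `hom_eq_zero_of_dim_eq_zero` (`Motives/AbelianVarietyDimZeroProofs.lean`) every homomorphism out
  of or into a `0`-dimensional abelian variety is `0`, in particular `𝟙 A = 0`, so the zero
  homomorphisms `A → B`, `B → A` are mutually inverse;
* `exists_isoClasses_isogenous_of_dim_eq_zero` — hence the isogeny class of a `0`-dimensional `A`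
  consists of a single isomorphism class (an isogeny preserves dimension,
  `dim_eq_of_isIsogenous_holds`, `Motives/AbelianVarietyIsogenyProofs.lean`), with the one
  representative `C₀ = A`;
* `finite_isoClasses_isogenous_of_dim_eq_zero` — the named fact `finite_isoClasses_isogenous A`
  itself for `dim A = 0`.

No definitions, no named facts; pure consequences of the two discharged facts quoted.

## References

* [MilneAV2008] J. S. Milne, *Abelian Varieties*, course notes v2.00 (2008), Ch. IV, Thm. 1.1
  (Finiteness I), p. 131 — the statement whose `dim A = 0` case is settled here.
* [MumfordAV1970] D. Mumford, *Abelian Varieties*, §4 (an abelian variety of dimension `0` is the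
  trivial group scheme `Spec k`).
-/

noncomputable section

universe u

open CategoryTheory

namespace Literature.AlgebraicGeometry.Motives.AbelianVariety

variable {K : Type u} [Field K]

/-- **Abelian varieties of dimension `0` are isomorphic to one another** (both are the zero
abelian variety `Spec K`; Mumford, *Abelian Varieties*, §4). Proof: every homomorphism with a
`0`-dimensional source or target vanishes (`hom_eq_zero_of_dim_eq_zero`), so `𝟙 A = 0 = 0 ≫ 0`
and likewise for `B`; the zero homomorphisms are therefore mutually inverse isomorphisms in
`AbelianVariety K`. [folklore] -/
theorem nonempty_iso_of_dim_eq_zero (A B : AbelianVariety K) (hA : A.dim = 0) (hB : B.dim = 0) :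
    Nonempty (A ≅ B) :=
  ⟨{ hom := 0
     inv := 0
     hom_inv_id := (hom_eq_zero_of_dim_eq_zero (Or.inl hA) _).trans
       (hom_eq_zero_of_dim_eq_zero (Or.inl hA) _).symm
     inv_hom_id := (hom_eq_zero_of_dim_eq_zero (Or.inl hB) _).trans
       (hom_eq_zero_of_dim_eq_zero (Or.inl hB) _).symm }⟩

/-- **The isogeny class of a `0`-dimensional abelian variety is a single isomorphism class**:
if `dim A = 0` then every `B` admitting an isogeny `B → A` has `dim B = dim A = 0`
(`dim_eq_of_isIsogenous_holds`: a finite surjective morphism preserves dimension) and is therefore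
isomorphic to `A` (`nonempty_iso_of_dim_eq_zero`); so the family of representatives may be taken
to be the single `C₀ = A`. This is the `dim A = 0` case of Faltings' Finiteness I (Milne,
*Abelian Varieties* (2008), IV Thm. 1.1), over an arbitrary field. [folklore] -/
theorem exists_isoClasses_isogenous_of_dim_eq_zero (A : AbelianVariety K) (hA : A.dim = 0) :
    ∃ (n : ℕ) (C : Fin n → AbelianVariety K),
      ∀ B : AbelianVariety K, IsIsogenous B A → ∃ i, Nonempty (B ≅ C i) :=
  ⟨1, fun _ ↦ A, fun B hB ↦
    ⟨0, nonempty_iso_of_dim_eq_zero B A ((dim_eq_of_isIsogenous_holds hB).trans hA) hA⟩⟩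

/-- **Finiteness I in dimension `0`** (unconditional): the named fact
`finite_isoClasses_isogenous A` (Faltings' Finiteness I; Milne, *Abelian Varieties* (2008), IV
Thm. 1.1) holds for every abelian variety `A` of dimension `0` over any field — its isogeny class
is the single isomorphism class of the zero abelian variety
(`exists_isoClasses_isogenous_of_dim_eq_zero`; the fact's inner `[NumberField K]` binder is not
used). [folklore] -/
theorem finite_isoClasses_isogenous_of_dim_eq_zero (A : AbelianVariety K) (hA : A.dim = 0) :
    finite_isoClasses_isogenous A :=
  exists_isoClasses_isogenous_of_dim_eq_zero A hA

end Literature.AlgebraicGeometry.Motives.AbelianVariety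

end
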